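import Summits.AtomisticToContinuum.HydrodynamicLimit.Theorems.JParityClosureEvenStressEnskogLocalGibbsReduction
import Summits.AtomisticToContinuum.HydrodynamicLimit.Theorems.SuperextensiveClosureCostTransferInequality
import Literature.Probability.Divergences.EntropyEventBound
import HarnessLib

/-!
# Strategist sketch — typed census objects for the crux `JParityClosure.EvenStressEnskog`
# (stmt-AtomisticToContinuum-13079; planner-cstrat-stmt-AtomisticToContinuum-13079-s1-0, 2026-08-17)

Companion of `STRATEGY-CENSUS.md` (crux work-dir).  Every object named in the census is typed here
over tree declarations and kernel-checked where a proof is claimed: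

* §D  DECOMPOSITION (the sides split): `ContactSideTested`, `EnskogSideTested` = the hypotheses
      `hC`, `hE` of the LANDED `Theorems.EvenStressEnskog.evenStressEnskog_of_sides` (p134979) as named
      `Prop`s; `EvenStressEnskog_of_subs` (the glue, by name) and the landed converse.
* §R  RECOMMENDED RESTATEMENT for the tenure planner (remark R of the triage, Disproof §12, leads
      c1/c4/c5/a1): `EvenContactLawPreShock` = the contact side in the pre-shock Euler frame
      (`IsHardSphereEulerSolution` + `t = 0` LLN + `τ < T`), and `evenContactLawPreShock_of_contactSideTested`
      (it is a weakening of child 1).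
* §S  STRENGTHEN: `RelEntropyLocalEquilibrium` (Yau/OVY relative-entropy local equilibrium, `S⁺_H`) and the
      entropy–event inequality that would carry it to the crux (`Literature…toReal_measure_le_of_klDiv_le`).
* §T  TRANSFER: `EquilibriumSuperExp rN` (super-exponential estimate for the TRUNCATED even statistic under
      the flow-invariant homogeneous law at a scale sequence `rN`), the proved one-line `transfer_step`
      (from the landed `transferInequality_proof` shape `LG(S)² ≤ e^{C(N+1)} G(S)`), `MesoEvenStress rN`
      and `ScaleBridge rN` (the mesoscale split of the crux statistic).
* §N  NEGATION: the typed kill shape `TextureWitness` (= `¬ EnskogSideTested`), which together with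
      `ContactSideTested` refutes the crux (`not_evenStressEnskog_of_texture`, proved from the landed glue).
-/

noncomputable section

namespace Summit.AtomisticToContinuum.HydrodynamicLimit.Cruxes.EvenStressEnskog.Strategist

open scoped BigOperators InnerProductSpace Topology ENNReal
open MeasureTheory Filter Set InformationTheory
open Literature.MathematicalPhysics.KineticTheory Literature.Analysis.FluidPDE
open Literature.MathematicalPhysics.KineticTheory.StationaryMicroscale
open Summit.AtomisticToContinuum.HydrodynamicLimit.Theses.JParityClosure

/-! ## §D Decomposition: the two sides of the crux as named statements -/

/-- CHILD 1 (two-body content): the collision sum of the even marks `Ξ_P^{kl}` is close to the fully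
Maxwellian Enskog contact prediction `contactPredM` (contact value `Y`, Maxwellian velocities at
`(θ_r, u_r)`), in local-Gibbs probability, crux frame (`∀ τ`, all flows). Verbatim `hC` of
`Theorems.EvenStressEnskog.evenStressEnskog_of_sides`. -/
def ContactSideTested : Prop :=
  ∃ η₀ : ℝ, 0 < η₀ ∧ ∀ (a₀ θ₀ : T3 → ℝ) (u₀ : T3 → V3), Continuous a₀ → Continuous θ₀ → Continuous u₀ →
    (∀ x, 0 < a₀ x) → (∀ x, 0 < θ₀ x) → ∃ σ₀ : ℝ, 0 < σ₀ ∧ ∀ σ : ℝ, 0 < σ → σ < σ₀ →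
    ∀ Φ : (N : ℕ) → HardSphereFlow (Torus.geometry (Fin 3)) (hsDiameter σ N) (N + 1), ∀ τ : ℝ, 0 < τ →
    ∀ χ : ℝ × T3 → ℝ, Continuous χ → ∀ g : ℝ → ℝ, Continuous g → (∀ a, η₀ ≤ a → g a = 0) →
    ∀ k l : Fin 3,
    ∀ η δ : ℝ, 0 < η → 0 < δ → ∃ r₀ : ℝ, 0 < r₀ ∧ ∀ r : ℝ, 0 < r → r < r₀ → ∃ N₀ : ℕ, ∀ N : ℕ, N₀ ≤ N →
      localGibbsLaw σ a₀ u₀ θ₀ N (Φ N)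
        {z | η < |collisionSum σ N (Φ N) τ χ g (evenMark k l) r z - contactPredM σ N (Φ N) τ χ g (evenMark k l) r z|}
        ≤ ENNReal.ofReal δ

/-- CHILD 2 (one-body content): the fully Maxwellian prediction `contactPredM` is close to the crux's
own empirical Enskog functional `σ³∫₀^τ enskogRate` — by the landed identity
`contactPredM_sub_enskog_eq_oneBodyPred_sub_oneBodyStat` (p134407) this is ISOTROPY OF THE KINETIC
STRESS at scale `r` (traceless second velocity moments, `g·Ỹ·a`-weighted, time-and-`χ`-averaged).
Verbatim `hE` of `Theorems.EvenStressEnskog.evenStressEnskog_of_sides`. -/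
def EnskogSideTested : Prop :=
  ∃ η₀ : ℝ, 0 < η₀ ∧ ∀ (a₀ θ₀ : T3 → ℝ) (u₀ : T3 → V3), Continuous a₀ → Continuous θ₀ → Continuous u₀ →
    (∀ x, 0 < a₀ x) → (∀ x, 0 < θ₀ x) → ∃ σ₀ : ℝ, 0 < σ₀ ∧ ∀ σ : ℝ, 0 < σ → σ < σ₀ →
    ∀ Φ : (N : ℕ) → HardSphereFlow (Torus.geometry (Fin 3)) (hsDiameter σ N) (N + 1), ∀ τ : ℝ, 0 < τ →
    ∀ χ : ℝ × T3 → ℝ, Continuous χ → ∀ g : ℝ → ℝ, Continuous g → (∀ a, η₀ ≤ a → g a = 0) →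
    ∀ k l : Fin 3,
    ∀ η δ : ℝ, 0 < η → 0 < δ → ∃ r₀ : ℝ, 0 < r₀ ∧ ∀ r : ℝ, 0 < r → r < r₀ → ∃ N₀ : ℕ, ∀ N : ℕ, N₀ ≤ N →
      localGibbsLaw σ a₀ u₀ θ₀ N (Φ N)
        {z | η < |contactPredM σ N (Φ N) τ χ g (evenMark k l) r z
              - σ ^ 3 * ∫ s in Set.Icc (0 : ℝ) τ, enskogRate σ N χ g (evenMark k l) r s ((Φ N).flow s z)|}
        ≤ ENNReal.ofReal δ

/-- THE GLUE of the sides split, concluding the crux BY NAME from the landed theorem (p134979). -/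
theorem EvenStressEnskog_of_subs : ContactSideTested → EnskogSideTested → EvenStressEnskog :=
  fun hC hE => Theorems.EvenStressEnskog.evenStressEnskog_of_sides hC hE

/-- The landed converse: modulo child 2 the crux IS child 1. -/
theorem contactSideTested_of_crux (hX : EvenStressEnskog) (hE : EnskogSideTested) : ContactSideTested :=
  Theorems.EvenStressEnskog.contactSide_of_evenStressEnskog_of_enskogSide hX hE

/-- The symmetric converse (union bound the other way round): modulo child 1 the crux IS child 2. -/
theorem enskogSideTested_of_crux (hX : EvenStressEnskog) (hC : ContactSideTested) : EnskogSideTested := by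
  have hX' :
      ∃ η₀ : ℝ, 0 < η₀ ∧ ∀ (a₀ θ₀ : T3 → ℝ) (u₀ : T3 → V3), Continuous a₀ → Continuous θ₀ → Continuous u₀ →
        (∀ x, 0 < a₀ x) → (∀ x, 0 < θ₀ x) → ∃ σ₀ : ℝ, 0 < σ₀ ∧ ∀ σ : ℝ, 0 < σ → σ < σ₀ →
        ∀ Φ : (N : ℕ) → HardSphereFlow (Torus.geometry (Fin 3)) (hsDiameter σ N) (N + 1),
        ∀ τ : ℝ, 0 < τ → ∀ χ : ℝ × UnitAddTorus (Fin 3) → ℝ, Continuous χ → ∀ g : ℝ → ℝ, Continuous g →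
        (∀ a, η₀ ≤ a → g a = 0) →
        ∀ η δ : ℝ, 0 < η → 0 < δ → ∃ r₀ : ℝ, 0 < r₀ ∧ ∀ r : ℝ, 0 < r → r < r₀ →
        ∃ N₀ : ℕ, ∀ N : ℕ, N₀ ≤ N → ∀ k l : Fin 3,
          localGibbsLaw σ a₀ u₀ θ₀ N (Φ N) {z | η < |evenStat σ N (Φ N) τ χ g (evenMark k l) r z|}
            ≤ ENNReal.ofReal δ := hX
  obtain ⟨η₄, hη₄, H4⟩ := hX'
  obtain ⟨η₅, hη₅, H5⟩ := hC
  refine ⟨min η₄ η₅, lt_min hη₄ hη₅, ?_⟩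
  intro a₀ θ₀ u₀ ha hθ hu ha0 hθ0
  obtain ⟨σ₄, hσ₄, H4⟩ := H4 a₀ θ₀ u₀ ha hθ hu ha0 hθ0
  obtain ⟨σ₅, hσ₅, H5⟩ := H5 a₀ θ₀ u₀ ha hθ hu ha0 hθ0
  refine ⟨min σ₄ σ₅, lt_min hσ₄ hσ₅, ?_⟩
  intro σ hσ hσlt Φ τ hτ χ hχ g hg hg0 k l η δ hη hδ
  have hσ4 : σ < σ₄ := lt_of_lt_of_le hσlt (min_le_left _ _)
  have hσ5 : σ < σ₅ := lt_of_lt_of_le hσlt (min_le_right _ _)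
  have hg4 : ∀ a, η₄ ≤ a → g a = 0 := fun a h => hg0 a ((min_le_left _ _).trans h)
  have hg5 : ∀ a, η₅ ≤ a → g a = 0 := fun a h => hg0 a ((min_le_right _ _).trans h)
  have hη2 : 0 < η / 2 := by positivity
  have hδ2 : 0 < δ / 2 := by positivity
  obtain ⟨r₄, hr₄, H4'⟩ := H4 σ hσ hσ4 Φ τ hτ χ hχ g hg hg4 (η / 2) (δ / 2) hη2 hδ2
  obtain ⟨r₅, hr₅, H5'⟩ := H5 σ hσ hσ5 Φ τ hτ χ hχ g hg hg5 k l (η / 2) (δ / 2) hη2 hδ2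
  refine ⟨min r₄ r₅, lt_min hr₄ hr₅, fun r hr hrlt => ?_⟩
  have hr4 : r < r₄ := lt_of_lt_of_le hrlt (min_le_left _ _)
  have hr5 : r < r₅ := lt_of_lt_of_le hrlt (min_le_right _ _)
  obtain ⟨N₄, H4''⟩ := H4' r hr hr4
  obtain ⟨N₅, H5''⟩ := H5' r hr hr5
  refine ⟨max N₄ N₅, fun N hN => ?_⟩
  have E4 := H4'' N ((le_max_left _ _).trans hN) k l
  have E5 := H5'' N ((le_max_right _ _).trans hN)
  set P := localGibbsLaw σ a₀ u₀ θ₀ N (Φ N) with hP'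
  set K := fun z => collisionSum σ N (Φ N) τ χ g (evenMark k l) r z with hK
  set C := fun z => contactPredM σ N (Φ N) τ χ g (evenMark k l) r z with hC'
  set E := fun z => σ ^ 3 * ∫ s in Set.Icc (0 : ℝ) τ, enskogRate σ N χ g (evenMark k l) r s ((Φ N).flow s z)
    with hE'
  have hD : ∀ z, evenStat σ N (Φ N) τ χ g (evenMark k l) r z = K z - E z := fun z => rfl
  have hsub : {z | η < |C z - E z|}
      ⊆ {z | η / 2 < |evenStat σ N (Φ N) τ χ g (evenMark k l) r z|} ∪ {z | η / 2 < |K z - C z|} := by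
    intro z hz
    simp only [Set.mem_setOf_eq, Set.mem_union] at hz ⊢
    rw [hD z]
    by_contra hcon
    simp only [not_or, not_lt] at hcon
    obtain ⟨h1', h2'⟩ := hcon
    have : |C z - E z| ≤ |C z - K z| + |K z - E z| := abs_sub_le (C z) (K z) (E z)
    rw [abs_sub_comm (C z) (K z)] at this
    linarith
  calc P {z | η < |C z - E z|}
      ≤ P ({z | η / 2 < |evenStat σ N (Φ N) τ χ g (evenMark k l) r z|} ∪ {z | η / 2 < |K z - C z|}) :=
        measure_mono hsub
    _ ≤ P {z | η / 2 < |evenStat σ N (Φ N) τ χ g (evenMark k l) r z|} + P {z | η / 2 < |K z - C z|} :=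
        measure_union_le _ _
    _ ≤ ENNReal.ofReal (δ / 2) + ENNReal.ofReal (δ / 2) := add_le_add E4 E5
    _ = ENNReal.ofReal δ := by
        rw [← ENNReal.ofReal_add hδ2.le hδ2.le]
        congr 1
        ring

/-! ## §R Recommended restatement (tenure planner): the contact side in the pre-shock Euler frame -/

/-- `EvenContactLawPreShock` — child 1 restricted to what the glue `ParityInBand` consumes: classical
hs-Euler solution on `[0,T)`, flows tied to it by the `t = 0` LLN, horizons `τ < T`.  This is the
restated crux recommended by remark R / Disproof §12 / leads c1–a1 (typed here so that tenure can paste it). -/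
def EvenContactLawPreShock : Prop :=
  ∃ η₀ : ℝ, 0 < η₀ ∧ ∀ (a₀ θ₀ : T3 → ℝ) (u₀ : T3 → V3), Continuous a₀ → Continuous θ₀ → Continuous u₀ →
    (∀ x, 0 < a₀ x) → (∀ x, 0 < θ₀ x) → ∃ σ₀ : ℝ, 0 < σ₀ ∧ ∀ σ : ℝ, 0 < σ → σ < σ₀ →
    ∀ (T : ℝ) (ρ θ : ℝ → T3 → ℝ) (u : ℝ → T3 → V3), IsHardSphereEulerSolution σ T ρ u θ →
    ∀ Φ : (N : ℕ) → HardSphereFlow (Torus.geometry (Fin 3)) (hsDiameter σ N) (N + 1),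
    TendstoHydroFieldsAt (fun N => localGibbsLaw σ a₀ u₀ θ₀ N (Φ N)) Φ ρ u θ 0 →
    ∀ τ : ℝ, 0 < τ → τ < T →
    ∀ χ : ℝ × T3 → ℝ, Continuous χ → ∀ g : ℝ → ℝ, Continuous g → (∀ a, η₀ ≤ a → g a = 0) →
    ∀ k l : Fin 3,
    ∀ η δ : ℝ, 0 < η → 0 < δ → ∃ r₀ : ℝ, 0 < r₀ ∧ ∀ r : ℝ, 0 < r → r < r₀ → ∃ N₀ : ℕ, ∀ N : ℕ, N₀ ≤ N →
      localGibbsLaw σ a₀ u₀ θ₀ N (Φ N)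
        {z | η < |collisionSum σ N (Φ N) τ χ g (evenMark k l) r z - contactPredM σ N (Φ N) τ χ g (evenMark k l) r z|}
        ≤ ENNReal.ofReal δ

/-- The recommended restatement is a WEAKENING of child 1 (drop the Euler solution, the LLN and `τ < T`). -/
theorem evenContactLawPreShock_of_contactSideTested (h : ContactSideTested) : EvenContactLawPreShock := by
  obtain ⟨η₀, hη₀, H⟩ := h
  refine ⟨η₀, hη₀, fun a₀ θ₀ u₀ ha hθ hu ha0 hθ0 => ?_⟩
  obtain ⟨σ₀, hσ₀, H⟩ := H a₀ θ₀ u₀ ha hθ hu ha0 hθ0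
  refine ⟨σ₀, hσ₀, fun σ hσ hσlt T ρ θ u _hsol Φ _h0 τ hτ _hτT χ hχ g hg hg0 k l η δ hη hδ => ?_⟩
  exact H σ hσ hσlt Φ τ hτ χ hχ g hg hg0 k l η δ hη hδ

/-! ## §S Strengthen: relative-entropy local equilibrium (`S⁺_H`, the Yau / Olla–Varadhan–Yau target) -/

/-- `S⁺_H`: along the hard-sphere flow from local Gibbs data there are continuous positive parameter
fields `(a_s, u_s, θ_s)` such that the evolved law has relative entropy `o(N)` with respect to the local
Gibbs law with those parameters, uniformly in `s ≤ τ`.  This is the conclusion of the relative-entropy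
METHOD (Yau 1991, OVY 1993 with noise) and implies every local-equilibrium replacement, the crux included
(entropy–event inequality `Literature.Probability.Divergences.toReal_measure_le_of_klDiv_le` + a static
exponential bound under the local Gibbs law + the landed cluster-transport identity); its only known proof
needs the ergodic decomposition of the infinite dynamics (`Literature.Barriers.AtomisticToContinuum.
BoltzmannHypothesisBarrier`).  Typed for the census; NOT proposed as an item. -/
def RelEntropyLocalEquilibrium : Prop :=
  ∀ (a₀ θ₀ : T3 → ℝ) (u₀ : T3 → V3), Continuous a₀ → Continuous θ₀ → Continuous u₀ →
    (∀ x, 0 < a₀ x) → (∀ x, 0 < θ₀ x) → ∃ σ₀ : ℝ, 0 < σ₀ ∧ ∀ σ : ℝ, 0 < σ → σ < σ₀ →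
    ∀ Φ : (N : ℕ) → HardSphereFlow (Torus.geometry (Fin 3)) (hsDiameter σ N) (N + 1), ∀ τ : ℝ, 0 < τ →
    ∃ (a θ : ℝ → T3 → ℝ) (u : ℝ → T3 → V3),
      (∀ s, Continuous (a s)) ∧ (∀ s, Continuous (θ s)) ∧ (∀ s, Continuous (u s)) ∧
      (∀ s x, 0 < a s x) ∧ (∀ s x, 0 < θ s x) ∧
      ∀ δ : ℝ, 0 < δ → ∃ N₀ : ℕ, ∀ N : ℕ, N₀ ≤ N → ∀ s ∈ Set.Icc (0 : ℝ) τ,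
        klDiv ((localGibbsLaw σ a₀ u₀ θ₀ N (Φ N)).map ((Φ N).flow s))
            (localGibbsLaw σ (a s) (u s) (θ s) N (Φ N)) ≤ ENNReal.ofReal (δ * (N + 1))

/-- The one inequality by which `S⁺_H` would be CARRIED to any tested event: if the event is
exponentially rare under the reference law and the entropy is `≤ H`, its probability is `≤ (log 2 + H)/G`
(tree theorem, Kipnis–Landim App. 1 Prop. 8.2).  With `H = δ(N+1)` and `G = c(N+1)` the bound is
`(log 2)/(c(N+1)) + δ/c`: `o(N)` entropy + EXPONENTIAL (not super-exponential) rarity suffice. -/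
theorem entropy_event_transport {α : Type*} [MeasurableSpace α] (Q P : Measure α)
    [IsProbabilityMeasure Q] [IsProbabilityMeasure P] {A : Set α} (hA : MeasurableSet A) {G H : ℝ}
    (hG : 0 < G) (hH : 0 ≤ H) (hP : P A ≤ ENNReal.ofReal (Real.exp (-G)))
    (hKL : klDiv Q P ≤ ENNReal.ofReal H) : (Q A).toReal ≤ (Real.log 2 + H) / G :=
  Literature.Probability.Divergences.toReal_measure_le_of_klDiv_le Q P hA hG hH hP hKL

/-! ## §T Transfer: the `L²` / large-deviation transfer to the flow-invariant homogeneous law -/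

/-- `EquilibriumSuperExp rN`: under the HOMOGENEOUS canonical law (activity `1`, velocity `0`,
temperature `θe`; flow-invariant, `map_flow_localGibbsLaw_const`) the crux event for the TRUNCATED even
mark `evenMarkTrunc k l L` (bounded, so no energy-`≍N` outlier can move it) read at scale `rN N` is
super-exponentially rare: `∀ M, G_N(η < |evenStat|) ≤ e^{−M(N+1)}` eventually.  At a FIXED scale
`rN ≡ r` this is FALSE (lead c5 finding F1: the laminar shear texture `u = U sin(2πx₂/ℓ)e₁`, `ℓ = r/2`,
costs `e^{−NU²/(4θ)}` only and separates the two sides by `≍ σ³YU²` for all `s ≤ τ`); at a mesoscale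
`rN N = (N+1)^{−1/3+a}`, `0 < a < 1/6`, it is the bet of the route rationale's LD engine (card
subkolmogorov-twist-ld-transfer, stated there for the odd crux) — a super-exponential two-time
equilibrium bound for deterministic spheres, not in print. -/
def EquilibriumSuperExp (rN : ℕ → ℝ) : Prop :=
  ∃ η₀ : ℝ, 0 < η₀ ∧ ∀ θe : ℝ, 0 < θe → ∃ σ₀ : ℝ, 0 < σ₀ ∧ ∀ σ : ℝ, 0 < σ → σ < σ₀ →
    ∀ Φ : (N : ℕ) → HardSphereFlow (Torus.geometry (Fin 3)) (hsDiameter σ N) (N + 1), ∀ τ : ℝ, 0 < τ →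
    ∀ χ : ℝ × T3 → ℝ, Continuous χ → ∀ g : ℝ → ℝ, Continuous g → (∀ a, η₀ ≤ a → g a = 0) →
    ∀ (k l : Fin 3) (L : ℝ), 0 < L → ∀ η M : ℝ, 0 < η → ∃ N₀ : ℕ, ∀ N : ℕ, N₀ ≤ N →
      localGibbsLaw σ (fun _ => 1) (fun _ => 0) (fun _ => θe) N (Φ N)
        {z | η < |evenStat σ N (Φ N) τ χ g (evenMarkTrunc k l L) (rN N) z|}
        ≤ ENNReal.ofReal (Real.exp (-(M * (N + 1))))

/-- `x² ≤ a²` in `ℝ≥0∞` gives `x ≤ a`. -/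
theorem le_ofReal_of_sq_le {x : ℝ≥0∞} {a : ℝ} (ha : 0 ≤ a) (h : x ^ 2 ≤ ENNReal.ofReal (a ^ 2)) :
    x ≤ ENNReal.ofReal a := by
  rw [ENNReal.ofReal_pow ha] at h
  exact (ENNReal.pow_le_pow_left_iff two_ne_zero).1 h

/-- **THE TRANSFER STEP IS A ONE-LINER** (so all content of an LD-transfer line sits in its
`EquilibriumSuperExp` hypothesis): from the landed static budget `LG(S)² ≤ e^{Cn}·G(S)`
(`transferInequality_proof`, shape only) and `G(S) ≤ e^{−Mn}` one gets `LG(S) ≤ e^{−(M−C)n/2}`. -/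
theorem transfer_step {α : Type*} [MeasurableSpace α] (P G : Measure α) (S : Set α) {C M n : ℝ}
    (hT : P S ^ 2 ≤ ENNReal.ofReal (Real.exp (C * n)) * G S)
    (hG : G S ≤ ENNReal.ofReal (Real.exp (-(M * n)))) :
    P S ≤ ENNReal.ofReal (Real.exp (-((M - C) / 2 * n))) := by
  apply le_ofReal_of_sq_le (Real.exp_pos _).le
  calc P S ^ 2 ≤ ENNReal.ofReal (Real.exp (C * n)) * G S := hT
    _ ≤ ENNReal.ofReal (Real.exp (C * n)) * ENNReal.ofReal (Real.exp (-(M * n))) := by gcongr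
    _ = ENNReal.ofReal (Real.exp (C * n) * Real.exp (-(M * n))) :=
        (ENNReal.ofReal_mul (Real.exp_pos _).le).symm
    _ = ENNReal.ofReal (Real.exp (-((M - C) / 2 * n)) ^ 2) := by
        congr 1
        rw [← Real.exp_add, sq, ← Real.exp_add]
        congr 1
        ring

/-- `MesoEvenStress rN`: the crux statistic with the Enskog functional read at the scale `rN N`
(no `r → 0` limit: the scale goes to `0` with `N`), in local-Gibbs probability, for the truncated marks.
Child A of the mesoscale split. -/
def MesoEvenStress (rN : ℕ → ℝ) : Prop :=
  ∃ η₀ : ℝ, 0 < η₀ ∧ ∀ (a₀ θ₀ : T3 → ℝ) (u₀ : T3 → V3), Continuous a₀ → Continuous θ₀ → Continuous u₀ →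
    (∀ x, 0 < a₀ x) → (∀ x, 0 < θ₀ x) → ∃ σ₀ : ℝ, 0 < σ₀ ∧ ∀ σ : ℝ, 0 < σ → σ < σ₀ →
    ∀ Φ : (N : ℕ) → HardSphereFlow (Torus.geometry (Fin 3)) (hsDiameter σ N) (N + 1), ∀ τ : ℝ, 0 < τ →
    ∀ χ : ℝ × T3 → ℝ, Continuous χ → ∀ g : ℝ → ℝ, Continuous g → (∀ a, η₀ ≤ a → g a = 0) →
    ∀ (k l : Fin 3) (L : ℝ), 0 < L → ∀ η δ : ℝ, 0 < η → 0 < δ → ∃ N₀ : ℕ, ∀ N : ℕ, N₀ ≤ N →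
      localGibbsLaw σ a₀ u₀ θ₀ N (Φ N)
        {z | η < |evenStat σ N (Φ N) τ χ g (evenMarkTrunc k l L) (rN N) z|} ≤ ENNReal.ofReal δ

/-- `ScaleBridge rN`: the ONE-BODY half of the mesoscale split — the Enskog functional at the fixed
macroscopic scale `r` and at the mesoscale `rN N` have the same time integral up to `o(1)` in local-Gibbs
probability (`N → ∞` then `r → 0`): "no density / velocity texture between `rN` and `r`", i.e. strong
(not Young-measure) compactness of the empirical one-body field at mesoscales — exactly the hidden
content of Disproof §12; plausible pre-shock, open (and the natural home of any post-shock failure). -/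
def ScaleBridge (rN : ℕ → ℝ) : Prop :=
  ∃ η₀ : ℝ, 0 < η₀ ∧ ∀ (a₀ θ₀ : T3 → ℝ) (u₀ : T3 → V3), Continuous a₀ → Continuous θ₀ → Continuous u₀ →
    (∀ x, 0 < a₀ x) → (∀ x, 0 < θ₀ x) → ∃ σ₀ : ℝ, 0 < σ₀ ∧ ∀ σ : ℝ, 0 < σ → σ < σ₀ →
    ∀ Φ : (N : ℕ) → HardSphereFlow (Torus.geometry (Fin 3)) (hsDiameter σ N) (N + 1), ∀ τ : ℝ, 0 < τ →
    ∀ χ : ℝ × T3 → ℝ, Continuous χ → ∀ g : ℝ → ℝ, Continuous g → (∀ a, η₀ ≤ a → g a = 0) →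
    ∀ (k l : Fin 3) (L : ℝ), 0 < L → ∀ η δ : ℝ, 0 < η → 0 < δ →
    ∃ r₀ : ℝ, 0 < r₀ ∧ ∀ r : ℝ, 0 < r → r < r₀ → ∃ N₀ : ℕ, ∀ N : ℕ, N₀ ≤ N →
      localGibbsLaw σ a₀ u₀ θ₀ N (Φ N)
        {z | η < |(σ ^ 3 * ∫ s in Set.Icc (0 : ℝ) τ, enskogRate σ N χ g (evenMarkTrunc k l L) r s ((Φ N).flow s z))
              - σ ^ 3 * ∫ s in Set.Icc (0 : ℝ) τ, enskogRate σ N χ g (evenMarkTrunc k l L) (rN N) s ((Φ N).flow s z)|}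
        ≤ ENNReal.ofReal δ

/-! ## §N Negation: the typed kill shape -/

/-- A TEXTURE WITNESS is exactly a failure of child 2 (sub-`r` two-stream / shear texture on a set of
positive space-time measure, Disproof §12 `pairFunctionalP_two_stream`): typed as `¬ EnskogSideTested`. -/
def TextureWitness : Prop := ¬ EnskogSideTested

/-- If contacts stay Enskog–Maxwellian (child 1) while a texture witness exists, the crux is FALSE —
so a refuter hunting `¬ EvenStressEnskog` without a two-body anomaly must produce persistent mesoscale
texture from CONTINUOUS local-Gibbs profiles within an `N`-independent time (obstructed: thermal seeds
need `≍ log N` growth time; post-singularity roll-up is K41-compact in the crux's `N → ∞` then `r → 0` order). -/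
theorem not_evenStressEnskog_of_texture (hC : ContactSideTested) (hW : TextureWitness) : ¬ EvenStressEnskog :=
  fun hX => hW (enskogSideTested_of_crux hX hC)

end Summit.AtomisticToContinuum.HydrodynamicLimit.Cruxes.EvenStressEnskog.Strategist

end
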